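import Summits.CriticalPhenomena.PercolationContinuityZ3.Theorems.PercNearOneGluingNoHeavyLowerTailSahiThreeCopyTwoPointCertsK5
import Summits.CriticalPhenomena.PercolationContinuityZ3.Theorems.PercNearOneGluingNoHeavyLowerTailSahiThreeCopyPairs
import Summits.CriticalPhenomena.PercolationContinuityZ3.Theorems.PercNearOneGluingNoHeavyLowerTailSahiThreeCopyBernstein

/-!
# `NoHeavyLowerTail` (crux stmt-CriticalPhenomena-4575), Sahi programme: **THE FIVE-JUNTA THEOREM FOR 3C-SAHI** — if ONE of
# three nonnegative monotone functions on `{0,1}^n` depends on at most five coordinates (any five, any `n`), the three-copy Sahi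
# coefficient `c_b(F,G,H)` is nonnegative at EVERY profile; hence Kahn's `E₃ ≥ 0` / Sahi's `C₃` under every product measure for
# every such triple, the other two functions ARBITRARY

Support file (Sahi cell, seat `prim-sahi-p1`, generation 62; `--supports stmt-CriticalPhenomena-4575`).  COMPUTATIONAL through the import of
the `k = 5` certificate theorem `tc_front5_nonneg_all` (`…SahiThreeCopyTwoPointCertsK5`, generation 61: flow-form / face-form sandwich
certificates for all 3710 `S₅`-orbits of (up-set, profile), kernel-evaluated by `native_decide`); nothing else non-standard, no `sorry`,
no definitions.

WHAT IS NEW.  `tc_front5_nonneg_all` is stated for the slot `1_A ∘ front` — the indicator of an up-set of the FIRST five coordinates of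
`{0,1}^{d+5}`.  This file removes the three cosmetic restrictions (indicator → nonnegative monotone function, by the finite layer cake;
first five coordinates → ANY set `T` of at most five coordinates, by renaming coordinates, `tc_reindex`; `n ≥ 5` → any `n`, by
`…CubeFour` for `n ≤ 4`) and packages the result in the vocabulary of the structure theorems (`DependsOn` of `…IndependentPair`, `UGood`
of `…Pairs`, `FrontGood` of `…TwoPointFront`):
* `tc_frontFn_five_nonneg` — `0 ≤ c_B(frontFn 5 f, G, H)` for every nonnegative monotone `f : {0,1}^5 → ℝ` (not only indicators);
* `exists_perm_front` — a permutation of `Fin (d+5)` carrying a given five-element set of coordinates into the front block;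
* `comp_rePt_eq_frontFn` — after that renaming, a function depending only on those coordinates IS a front function;
* ★★★ `tc_nonneg_of_junta_five` — for every `n`, every profile `b`, every `T ⊆ Fin n` with `|T| ≤ 5` and all nonnegative monotone
  `F, G, H : {0,1}^n → ℝ` with `F` depending only on the coordinates in `T`: `0 ≤ c_b(F,G,H)`; the junta may sit in any slot
  (`tc_nonneg_of_junta_five₂`, `tc_nonneg_of_junta_five₃`); composition form `tc_nonneg_of_comp_five` (`F = f ∘ (x ↦ x ∘ ι)` for any
  `ι : Fin k → Fin n`, `k ≤ 5`); events form `tc_setInd_nonneg_of_junta_five`; pairs form `uGood_of_junta_five` (a five-junta is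
  universally good against everything); slot form `frontGood_of_junta_five` (a front slot of any width `k` that reads `≤ 5` of its coordinates);
* ★★ `sahiE_three_coin_nonneg_of_junta_five` — LAW LEVEL: for every product measure on `{0,1}^n` (coin weights `q ∈ [0,1]^n`) and all
  nonnegative monotone `F, G, H` with `F` a five-junta, Sahi's `E₃^{coin q}(F,G,H) ≥ 0` — Kahn's Conjecture 5 [Kahn2022, Conj. 5] / Sahi's
  `C₃` [Sahi2008, Conj. 5] for this class, in every dimension.  (The tree's earlier junta-SLOT theorems at law level reach three coordinates
  by transport certificates, `SahiJuntaSlotThree.sahiE_three_orAnd_nonneg` etc. of cell `prim-l12`; the comb/junta-INTERSECTION theorems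
  `SahiCombJunta.…_card_le_five` concern triples whose pairwise intersection is a junta — a different class.)
HONEST LABEL: computational (closure as stated); 3C-SAHI (`ThreeCopySahi`) and Kahn's Conjecture 5 in general remain OPEN; the first slot
not covered by this theorem or the structure theorems is a genuine six-junta such as `C₆ = (x₀∨x₁)(x₂∨x₃)(x₄∨x₅)` against two arbitrary
functions (memo FROM-prim-sahi-p1-gen60 §8, gen61 §4b). [this work]
-/

namespace Summit.CriticalPhenomena.PercolationContinuityZ3.Theorems.SahiThreeCopy

open Finset Function Literature.Combinatorics.Sahi2008
open scoped BigOperators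

noncomputable section

variable {d n : ℕ}

/-! ### §1 The `k = 5` theorem for FUNCTION slots (layer cake) -/

/-- `frontFn` is additive. [this work] -/
theorem frontFn_add (k : ℕ) (f g : Pt k → ℝ) : frontFn (d := d) k (f + g) = frontFn k f + frontFn k g := by
  funext w; simp only [frontFn_apply, Pi.add_apply]

/-- `frontFn` is homogeneous. [this work] -/
theorem frontFn_smul (k : ℕ) (c : ℝ) (f : Pt k → ℝ) : frontFn (d := d) k (c • f) = c • frontFn k f := by
  funext w; simp only [frontFn_apply, Pi.smul_apply]

/-- `frontFn` of the zero function. [this work] -/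
theorem frontFn_zero (k : ℕ) : frontFn (d := d) k (0 : Pt k → ℝ) = 0 := by
  funext w; simp only [frontFn_apply, Pi.zero_apply]

/-- ★ **The `k = 5` certificate theorem for an arbitrary nonnegative monotone front FUNCTION** (layer cake over `tc_front5_nonneg_all`):
`0 ≤ c_B(frontFn 5 f, G, H)` for every profile `B` of `{0,1}^{d+5}` and all nonnegative monotone `G, H`. [this work] -/
theorem tc_frontFn_five_nonneg (B : Fin (d + 5) → ℕ) {f : Pt 5 → ℝ} (hf : ∀ e, 0 ≤ f e) (hfm : Monotone f)
    {G H : Pt (d + 5) → ℝ} (hG : ∀ w, 0 ≤ G w) (hH : ∀ w, 0 ≤ H w) (hGm : Monotone G) (hHm : Monotone H) :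
    0 ≤ tc B (frontFn 5 f) G H := by
  classical
  obtain ⟨l, hl, rfl⟩ := exists_upperSet_decomposition f hf hfm
  clear hf hfm
  induction l with
  | nil =>
    rw [List.map_nil, List.sum_nil, frontFn_zero]
    have h0 := tc_smul_left B 0 (0 : Pt (d + 5) → ℝ) G H
    rw [zero_mul, zero_smul] at h0
    rw [h0]
  | cons p l ih =>
    rw [List.map_cons, List.sum_cons, frontFn_add, frontFn_smul, tc_add_left, tc_smul_left]
    have hp := hl p (by simp)
    exact add_nonneg (mul_nonneg hp.1 (tc_front5_nonneg_all B hp.2 hG hH hGm hHm))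
      (ih fun p' hp' => hl p' (List.mem_cons_of_mem _ hp'))

/-! ### §2 Renaming a five-element set of coordinates into the front block -/

/-- Dependence on a set of coordinates is inherited by supersets. [this work] -/
theorem DependsOn.mono {F : Pt n → ℝ} {T T' : Finset (Fin n)} (h : DependsOn F T) (hTT' : T ⊆ T') : DependsOn F T' :=
  fun x y hxy => h x y fun i hi => hxy i (hTT' hi)

/-- ★ For every five-element set `T` of coordinates of `{0,1}^{d+5}` there is a permutation `σ` of the coordinates with `σ(T)` = the front
block `{0,…,4}` (as an inequality on values: `σ i < 5` for `i ∈ T`). [this work] -/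
theorem exists_perm_front {T : Finset (Fin (d + 5))} (hT : T.card = 5) :
    ∃ σ : Equiv.Perm (Fin (d + 5)), ∀ i ∈ T, ((σ i : Fin (d + 5)) : ℕ) < 5 := by
  classical
  have hcT : Fintype.card {i // i ∈ T} = 5 := by rw [Fintype.card_coe]; exact hT
  have hcC : Fintype.card {i // ¬ i ∈ T} = d := by
    rw [Fintype.card_subtype_compl, Fintype.card_fin, hcT]; omega
  let eT : {i // i ∈ T} ≃ Fin 5 := Fintype.equivFinOfCardEq hcT
  let eC : {i // ¬ i ∈ T} ≃ Fin d := Fintype.equivFinOfCardEq hcC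
  let σ : Equiv.Perm (Fin (d + 5)) :=
    ((Equiv.sumCompl fun i => i ∈ T).symm.trans (eT.sumCongr eC)).trans
      (finSumFinEquiv.trans (finCongr (Nat.add_comm 5 d)))
  refine ⟨σ, fun i hi => ?_⟩
  have e1 : σ i = finCongr (Nat.add_comm 5 d) (finSumFinEquiv (Sum.map eT eC ((Equiv.sumCompl fun i => i ∈ T).symm i))) := rfl
  rw [e1, Equiv.sumCompl_symm_apply_of_pos hi, Sum.map_inl, finSumFinEquiv_apply_left, finCongr_apply, Fin.val_cast,
    Fin.val_castAdd]
  exact (eT ⟨i, hi⟩).isLt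

/-- Extending a point of the five-cube to the big cube by `false` off the front block is monotone. [this work] -/
theorem extFront_mono :
    Monotone (fun (e : Pt 5) (i : Fin (d + 5)) => if h : (i : ℕ) < 5 then e ⟨i, h⟩ else false) := by
  intro e e' h i
  show (if h : (i : ℕ) < 5 then e ⟨i, h⟩ else false) ≤ (if h : (i : ℕ) < 5 then e' ⟨i, h⟩ else false)
  split_ifs with hi
  · exact h _
  · exact le_rfl

/-- ★ **After renaming, a junta is a front function**: if `F` depends only on the coordinates in `T` and `σ` carries `T` into the front
block, then `F ∘ σ^* = frontFn 5 f` with `f(e) = F(σ^*(e extended by false))`. [this work] -/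
theorem comp_rePt_eq_frontFn {F : Pt (d + 5) → ℝ} {T : Finset (Fin (d + 5))} (hF : DependsOn F T)
    (σ : Equiv.Perm (Fin (d + 5))) (hσ : ∀ i ∈ T, ((σ i : Fin (d + 5)) : ℕ) < 5) :
    (fun x => F (rePt σ x)) =
      frontFn 5 (fun e => F (rePt σ (fun i => if h : (i : ℕ) < 5 then e ⟨i, h⟩ else false))) := by
  funext w
  rw [frontFn_apply]
  refine hF _ _ fun i hi => ?_
  simp only [rePt, dif_pos (hσ i hi)]

/-! ### §3 The five-junta theorem -/

/-- ★★★ **THE FIVE-JUNTA THEOREM FOR 3C-SAHI.**  For every `n`, every profile `b`, every set `T` of at most five coordinates and all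
nonnegative monotone `F, G, H : {0,1}^n → ℝ` such that `F` depends only on the coordinates in `T`:  `0 ≤ c_b(F, G, H)`.
(`n ≤ 4`: `…CubeFour`; otherwise rename `T` into the front block and apply the `k = 5` certificate theorem.) [this work] -/
theorem tc_nonneg_of_junta_five {T : Finset (Fin n)} (hT : T.card ≤ 5) (b : Fin n → ℕ) {F G H : Pt n → ℝ}
    (hFT : DependsOn F T) (hF : ∀ x, 0 ≤ F x) (hFm : Monotone F) (hG : ∀ x, 0 ≤ G x) (hGm : Monotone G)
    (hH : ∀ x, 0 ≤ H x) (hHm : Monotone H) : 0 ≤ tc b F G H := by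
  classical
  by_cases hn : n ≤ 4
  · exact tc_nonneg_of_le_four hn b hF hG hH hFm hGm hHm
  · obtain ⟨d, rfl⟩ : ∃ d, n = d + 5 := ⟨n - 5, by omega⟩
    obtain ⟨T', hTT', -, hT'⟩ := Finset.exists_subsuperset_card_eq (Finset.subset_univ T) hT
      (by rw [Finset.card_univ, Fintype.card_fin]; omega)
    obtain ⟨σ, hσ⟩ := exists_perm_front hT'
    rw [← tc_reindex σ b F G H, comp_rePt_eq_frontFn (hFT.mono hTT') σ hσ]
    exact tc_frontFn_five_nonneg _ (fun e => hF _) (fun e e' h => hFm (rePt_mono σ (extFront_mono h))) (fun x => hG _)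
      (fun x => hH _) (fun x y hxy => hGm (rePt_mono σ hxy)) (fun x y hxy => hHm (rePt_mono σ hxy))

/-- The five-junta in the SECOND slot. [this work] -/
theorem tc_nonneg_of_junta_five₂ {T : Finset (Fin n)} (hT : T.card ≤ 5) (b : Fin n → ℕ) {F G H : Pt n → ℝ}
    (hGT : DependsOn G T) (hF : ∀ x, 0 ≤ F x) (hFm : Monotone F) (hG : ∀ x, 0 ≤ G x) (hGm : Monotone G)
    (hH : ∀ x, 0 ≤ H x) (hHm : Monotone H) : 0 ≤ tc b F G H := by
  rw [tc_comm12]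
  exact tc_nonneg_of_junta_five hT b hGT hG hGm hF hFm hH hHm

/-- The five-junta in the THIRD slot. [this work] -/
theorem tc_nonneg_of_junta_five₃ {T : Finset (Fin n)} (hT : T.card ≤ 5) (b : Fin n → ℕ) {F G H : Pt n → ℝ}
    (hHT : DependsOn H T) (hF : ∀ x, 0 ≤ F x) (hFm : Monotone F) (hG : ∀ x, 0 ≤ G x) (hGm : Monotone G)
    (hH : ∀ x, 0 ≤ H x) (hHm : Monotone H) : 0 ≤ tc b F G H := by
  rw [tc_comm13]
  exact tc_nonneg_of_junta_five hT b hHT hH hHm hG hGm hF hFm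

/-- EVENTS FORM: up-sets `A, B, C ⊆ {0,1}^n` with membership in `A` decided by at most five coordinates: `0 ≤ c_b(1_A,1_B,1_C)` for
every profile. [this work] -/
theorem tc_setInd_nonneg_of_junta_five {T : Finset (Fin n)} (hT : T.card ≤ 5) (b : Fin n → ℕ) {A B C : Finset (Pt n)}
    (hAT : DependsOn (setInd A) T) (hA : IsUpperSet (A : Set (Pt n))) (hB : IsUpperSet (B : Set (Pt n)))
    (hC : IsUpperSet (C : Set (Pt n))) : 0 ≤ tc b (setInd A) (setInd B) (setInd C) :=
  tc_nonneg_of_junta_five hT b hAT (setInd_nonneg A) (monotone_setInd hA) (setInd_nonneg B) (monotone_setInd hB)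
    (setInd_nonneg C) (monotone_setInd hC)

/-- PAIRS FORM (`…Pairs`): a nonnegative monotone five-junta forms a universally good pair with EVERY nonnegative monotone function.
[this work] -/
theorem uGood_of_junta_five {T : Finset (Fin n)} (hT : T.card ≤ 5) {F G : Pt n → ℝ} (hFT : DependsOn F T)
    (hF : ∀ x, 0 ≤ F x) (hFm : Monotone F) (hG : ∀ x, 0 ≤ G x) (hGm : Monotone G) : UGood F G :=
  ⟨hF, hG, hFm, hGm, fun b _ hH hHm => tc_nonneg_of_junta_five hT b hFT hF hFm hG hGm hH hHm⟩

/-! ### §4 Composition and slot forms -/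

/-- Reading a point of `{0,1}^n` through a coordinate map `ι : Fin k → Fin n` (`x ↦ x ∘ ι`) is monotone. [this work] -/
theorem pullPt_mono {k : ℕ} (ι : Fin k → Fin n) : Monotone (fun (x : Pt n) (j : Fin k) => x (ι j)) :=
  fun _ _ hxy j => hxy (ι j)

/-- A function read through `ι` depends only on the image of `ι`. [this work] -/
theorem dependsOn_comp_pull {k : ℕ} (ι : Fin k → Fin n) (f : Pt k → ℝ) :
    DependsOn (fun x : Pt n => f (fun j => x (ι j))) (Finset.univ.image ι) := by
  classical
  intro x y hxy
  show f (fun j => x (ι j)) = f (fun j => y (ι j))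
  congr 1
  funext j
  exact hxy (ι j) (Finset.mem_image_of_mem ι (Finset.mem_univ j))

/-- COMPOSITION FORM: for `k ≤ 5`, ANY `ι : Fin k → Fin n` (not necessarily injective) and every nonnegative monotone `f : {0,1}^k → ℝ`,
the triple `(f(x ∘ ι), G, H)` satisfies `0 ≤ c_b` at every profile. [this work] -/
theorem tc_nonneg_of_comp_five {k : ℕ} (hk : k ≤ 5) (ι : Fin k → Fin n) (b : Fin n → ℕ) {f : Pt k → ℝ} (hf : ∀ e, 0 ≤ f e)
    (hfm : Monotone f) {G H : Pt n → ℝ} (hG : ∀ x, 0 ≤ G x) (hGm : Monotone G) (hH : ∀ x, 0 ≤ H x) (hHm : Monotone H) :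
    0 ≤ tc b (fun x => f (fun j => x (ι j))) G H := by
  classical
  refine tc_nonneg_of_junta_five (T := Finset.univ.image ι) ?_ b (dependsOn_comp_pull ι f) (fun x => hf _)
    (fun x y hxy => hfm (pullPt_mono ι hxy)) hG hGm hH hHm
  calc (Finset.univ.image ι).card ≤ (Finset.univ : Finset (Fin k)).card := Finset.card_image_le
    _ = k := by rw [Finset.card_univ, Fintype.card_fin]
    _ ≤ 5 := hk

/-- A front function of width `k` reading only the front coordinates in `T` depends, on the big cube, only on the copies of `T`. [this work] -/
theorem dependsOn_frontFn {k : ℕ} {f : Pt k → ℝ} {T : Finset (Fin k)} (hfT : DependsOn f T) :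
    DependsOn (frontFn (d := d) k f) (T.image fun j : Fin k => (⟨(j : ℕ), by omega⟩ : Fin (d + k))) := by
  classical
  intro x y hxy
  rw [frontFn_apply, frontFn_apply]
  refine hfT _ _ fun j hj => ?_
  exact hxy _ (Finset.mem_image_of_mem _ hj)

/-- SLOT FORM (`…TwoPointFront`): a front slot of ANY width `k` that reads at most five of its coordinates is universally good at every front
profile — `FrontGood k π f`. [this work] -/
theorem frontGood_of_junta_five {k : ℕ} {f : Pt k → ℝ} {T : Finset (Fin k)} (hT : T.card ≤ 5) (hfT : DependsOn f T)
    (hf : ∀ e, 0 ≤ f e) (hfm : Monotone f) (π : Fin k → ℕ) : FrontGood k π f := by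
  classical
  intro d b G H hG hH hGm hHm
  refine tc_nonneg_of_junta_five (T := T.image fun j : Fin k => (⟨(j : ℕ), by omega⟩ : Fin (d + k)))
    (le_trans Finset.card_image_le hT) _ (dependsOn_frontFn hfT) (fun w => ?_) (fun x y hxy => ?_) hG hGm hH hHm
  · rw [frontFn_apply]; exact hf _
  · rw [frontFn_apply, frontFn_apply]; exact hfm fun j => hxy _

/-! ### §5 Law level: Kahn's `E₃ ≥ 0` for triples with a five-junta -/

/-- ★★ **Kahn's Conjecture 5 / Sahi's `C₃` for triples with a five-junta, every product measure, every dimension.**  For coin weights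
`q ∈ [0,1]^n`, a set `T` of at most five coordinates and nonnegative monotone `F, G, H : {0,1}^n → ℝ` with `F` depending only on the
coordinates in `T`: `0 ≤ E₃^{coin q}(F, G, H)`. [this work; conjectures: cite Kahn2022 Conj. 5, Sahi2008 Conj. 5] -/
theorem sahiE_three_coin_nonneg_of_junta_five {q : Fin n → ℝ} (hq : ∀ i, 0 ≤ q i ∧ q i ≤ 1) {T : Finset (Fin n)}
    (hT : T.card ≤ 5) {F G H : Pt n → ℝ} (hFT : DependsOn F T) (hF : ∀ x, 0 ≤ F x) (hFm : Monotone F)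
    (hG : ∀ x, 0 ≤ G x) (hGm : Monotone G) (hH : ∀ x, 0 ≤ H x) (hHm : Monotone H) :
    0 ≤ sahiE (coinWeight q) 3 ![F, G, H] :=
  sahiE_three_coin_nonneg_of_tc hq fun b => tc_nonneg_of_junta_five hT b hFT hF hFm hG hGm hH hHm

/-- Law level, events: up-sets `A, B, C` of `{0,1}^n`, membership in `A` decided by at most five coordinates:
`0 ≤ E₃^{coin q}(1_A, 1_B, 1_C)` for every product measure. [this work] -/
theorem sahiE_three_coin_setInd_nonneg_of_junta_five {q : Fin n → ℝ} (hq : ∀ i, 0 ≤ q i ∧ q i ≤ 1) {T : Finset (Fin n)}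
    (hT : T.card ≤ 5) {A B C : Finset (Pt n)} (hAT : DependsOn (setInd A) T) (hA : IsUpperSet (A : Set (Pt n)))
    (hB : IsUpperSet (B : Set (Pt n))) (hC : IsUpperSet (C : Set (Pt n))) :
    0 ≤ sahiE (coinWeight q) 3 ![setInd A, setInd B, setInd C] :=
  sahiE_three_coin_nonneg_of_tc hq fun b => tc_setInd_nonneg_of_junta_five hT b hAT hA hB hC

end

end Summit.CriticalPhenomena.PercolationContinuityZ3.Theorems.SahiThreeCopy
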